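import Literature.Analysis.FluidPDE.ForcedSymmetryPreservation
import Literature.Analysis.FluidPDE.ClayForceTimeShift
import Literature.Analysis.FluidPDE.ClassicalSolutionGlue
import HarnessLib

/-!
# Symmetry preservation for forced finite-energy classical solutions on a SHIFTED slab `[t₀, t₁]`

Analysis/FluidPDE support file (cell `pub/ns-blowup`, seat `ns-blowup-lean` g8); companion of
`ForcedSymmetryPreservation.lean` (the slab `[0, T]`). LABEL: E–C typing / kernel plumbing (theorems
only). WHAT THIS IS NOT: not a statement about Navier–Stokes blow-up — uniqueness bookkeeping.

A Clay-class force `f` (smooth on `[0, ∞) × ℝ³`, Fefferman's decay (5)) restarted at `t₀ ≥ 0` is again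
of Clay class (`IsSmoothOnHalfSpace.timeShift`, `HasRapidSpaceTimeDecay.timeShift`,
`ClayForceTimeShift.lean`), and a classical solution on `[t₀, t₁]` translates to one on
`[0, t₁ − t₀]` with the shifted force (`IsClassicalNSSolutionOn.comp_add_right`). Hence the
symmetry-preservation theorems of the slab `[0, T]` hold on every slab `[t₀, t₁]`, `0 ≤ t₀ < t₁`, for
classical solutions of finite energy there whose slice `u t₀` is `H¹` and is fixed by the isometry:

* `IsClassicalNSSolutionOn.conj_eq_of_clayForce_Icc` — a linear isometry `R` of `ℝ³` fixing `u t₀`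
  and `f t` (`t ∈ [t₀, t₁]`) fixes `u t` for every `t ∈ [t₀, t₁]`;
* `IsClassicalNSSolutionOn.isAxisymmetric_of_clayForce_Icc`,
  `IsClassicalNSSolutionOn.hasNoSwirl_of_clayForce_Icc`.

This is the form needed for WINDOW RUNS of the E–C register (a run on `[τ₁ − ε, τ₂]` from a registered
stage's own state, `PalasekTowerHeredityWitnessWindow.lean`): the state at `τ₁ − ε` is symmetric by
`Stage.hasNoSwirl` (p441581), and the run inherits it.

References: A. J. Majda, A. L. Bertozzi, *Vorticity and Incompressible Flow*, CUP 2002, §1.2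
Prop. 1.1 (iii), §2.3.3 (2.52)–(2.53) [MajdaBertozziCUP2002]; T. Tao, Anal. PDE 6 (2013), Cor. 11.4
[Tao2011]; P. G. Lemarié-Rieusset, CRC Press 2016, §10.3 (10.20)–(10.21) [LemarieRieusset2016].
-/

noncomputable section

open MeasureTheory Set Function Filter Topology
open scoped ENNReal NNReal ContDiff

namespace Literature.Analysis.FluidPDE

section Shift

variable {ν t₀ t₁ : ℝ} {f u : ℝ → EuclideanSpace ℝ (Fin 3) → EuclideanSpace ℝ (Fin 3)}
  {p : ℝ → EuclideanSpace ℝ (Fin 3) → ℝ}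

/-- **Forced finite-energy classical solutions on `[t₀, t₁]` inherit every isometry symmetry of
their state at `t₀` and of the force (Clay-class force).** Let `ν > 0`, `0 ≤ t₀ < t₁`, `f` smooth on
`[0, ∞) × ℝ³` with Fefferman's decay, `(u, p)` a classical solution of the forced system on
`[t₀, t₁] × ℝ³` with finite energy there and `u t₀, ∇(u t₀) ∈ L²`. If a linear isometry `R` of `ℝ³`
fixes `u t₀` and fixes `f t` for `t ∈ [t₀, t₁]`, then `R (u t (R⁻¹ x)) = u t x` for every
`t ∈ [t₀, t₁]` (translate to `[0, t₁ − t₀]`, where the shifted force is again of Clay class, and apply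
`conj_eq_of_clayForce`). [cite: MajdaBertozziCUP2002, §1.2 Prop. 1.1 (iii) and §2.3.3 (2.52)–(2.53); Tao2011, Cor. 11.4] -/
theorem IsClassicalNSSolutionOn.conj_eq_of_clayForce_Icc
    (R : EuclideanSpace ℝ (Fin 3) ≃ₗᵢ[ℝ] EuclideanSpace ℝ (Fin 3)) (hν : 0 < ν) (ht₀ : 0 ≤ t₀)
    (ht : t₀ < t₁) (hfs : IsSmoothOnHalfSpace f) (hfd : HasRapidSpaceTimeDecay f)
    (hu : IsClassicalNSSolutionOn (Icc t₀ t₁) ν f u p)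
    (h₀ : MemLp (u t₀) 2 volume) (h₁ : MemLp (fderiv ℝ (u t₀)) 2 volume)
    (huE : ∃ C : ℝ≥0∞, C < ⊤ ∧ ∀ t ∈ Icc t₀ t₁, ∫⁻ x, ‖u t x‖ₑ ^ 2 ≤ C)
    (hfR : ∀ t ∈ Icc t₀ t₁, ∀ x, R (f t (R.symm x)) = f t x)
    (h0R : ∀ x, R (u t₀ (R.symm x)) = u t₀ x) :
    ∀ t ∈ Icc t₀ t₁, ∀ x, R (u t (R.symm x)) = u t x := by
  have hT : 0 < t₁ - t₀ := by linarith
  -- the translated solution on `[0, t₁ - t₀]` with the shifted (again Clay-class) force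
  have hv : IsClassicalNSSolutionOn (Icc 0 (t₁ - t₀)) ν (fun s => f (s + t₀)) (fun s => u (s + t₀))
      (fun s => p (s + t₀)) :=
    (hu.comp_add_right t₀).mono (fun s hs => ⟨by linarith [hs.1], by linarith [hs.2]⟩)
      (uniqueDiffOn_Icc hT)
  have hgs : IsSmoothOnHalfSpace (fun s => f (s + t₀)) := hfs.timeShift ht₀
  have hgd : HasRapidSpaceTimeDecay (fun s => f (s + t₀)) := hfd.timeShift hfs ht₀
  have hv0 : (fun s => u (s + t₀)) 0 = u t₀ := by simp only [zero_add]
  have hvE : ∃ C : ℝ≥0∞, C < ⊤ ∧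
      ∀ s ∈ Icc 0 (t₁ - t₀), ∫⁻ x, ‖(fun s => u (s + t₀)) s x‖ₑ ^ 2 ≤ C := by
    obtain ⟨C, hC, hb⟩ := huE
    exact ⟨C, hC, fun s hs => hb (s + t₀) ⟨by linarith [hs.1], by linarith [hs.2]⟩⟩
  have hgR : ∀ s ∈ Icc 0 (t₁ - t₀), ∀ x, R (f (s + t₀) (R.symm x)) = f (s + t₀) x :=
    fun s hs x => hfR (s + t₀) ⟨by linarith [hs.1], by linarith [hs.2]⟩ x
  have key := hv.conj_eq_of_clayForce R hν hT h₀ h₁ hgs hgd hv0 hvE hgR h0R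
  intro t ht' x
  have hs : t - t₀ ∈ Icc 0 (t₁ - t₀) := ⟨by linarith [ht'.1], by linarith [ht'.2]⟩
  have e := key (t - t₀) hs x
  simp only [sub_add_cancel] at e
  exact e

/-- **Axisymmetry is preserved on `[t₀, t₁]` (Clay-class force).** Under the hypotheses of
`conj_eq_of_clayForce_Icc`: if `u t₀` is axisymmetric and `f t` is axisymmetric for `t ∈ [t₀, t₁]`,
then `u t` is axisymmetric for every `t ∈ [t₀, t₁]`. [cite: MajdaBertozziCUP2002, §2.3.3 (2.52)–(2.53); Tao2011, Cor. 11.4] -/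
theorem IsClassicalNSSolutionOn.isAxisymmetric_of_clayForce_Icc (hν : 0 < ν) (ht₀ : 0 ≤ t₀)
    (ht : t₀ < t₁) (hfs : IsSmoothOnHalfSpace f) (hfd : HasRapidSpaceTimeDecay f)
    (hu : IsClassicalNSSolutionOn (Icc t₀ t₁) ν f u p)
    (h₀ : MemLp (u t₀) 2 volume) (h₁ : MemLp (fderiv ℝ (u t₀)) 2 volume)
    (huE : ∃ C : ℝ≥0∞, C < ⊤ ∧ ∀ t ∈ Icc t₀ t₁, ∫⁻ x, ‖u t x‖ₑ ^ 2 ≤ C)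
    (hfA : ∀ t ∈ Icc t₀ t₁, IsAxisymmetric (f t)) (h0A : IsAxisymmetric (u t₀)) :
    ∀ t ∈ Icc t₀ t₁, IsAxisymmetric (u t) := by
  intro t ht'
  rw [isAxisymmetric_iff_conj_rotZLIE]
  intro θ x
  exact hu.conj_eq_of_clayForce_Icc (rotZLIE θ) hν ht₀ ht hfs hfd h₀ h₁ huE
    (fun s hs y => (isAxisymmetric_iff_conj_rotZLIE (f s)).1 (hfA s hs) θ y)
    ((isAxisymmetric_iff_conj_rotZLIE (u t₀)).1 h0A θ) t ht' x

/-- **No swirl is preserved on `[t₀, t₁]` (Clay-class force).** Under the hypotheses of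
`conj_eq_of_clayForce_Icc`: if `u t₀` and `f t` (`t ∈ [t₀, t₁]`) are axisymmetric without swirl,
then `u t` has no swirl for every `t ∈ [t₀, t₁]` (meridian reflection `reflY`).
[cite: LemarieRieusset2016, §10.3 (10.20)–(10.21), p. 284; MajdaBertozziCUP2002, §2.3.3 (2.52)–(2.53)] -/
theorem IsClassicalNSSolutionOn.hasNoSwirl_of_clayForce_Icc (hν : 0 < ν) (ht₀ : 0 ≤ t₀)
    (ht : t₀ < t₁) (hfs : IsSmoothOnHalfSpace f) (hfd : HasRapidSpaceTimeDecay f)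
    (hu : IsClassicalNSSolutionOn (Icc t₀ t₁) ν f u p)
    (h₀ : MemLp (u t₀) 2 volume) (h₁ : MemLp (fderiv ℝ (u t₀)) 2 volume)
    (huE : ∃ C : ℝ≥0∞, C < ⊤ ∧ ∀ t ∈ Icc t₀ t₁, ∫⁻ x, ‖u t x‖ₑ ^ 2 ≤ C)
    (hfA : ∀ t ∈ Icc t₀ t₁, IsAxisymmetric (f t)) (hfS : ∀ t ∈ Icc t₀ t₁, HasNoSwirl (f t))
    (h0A : IsAxisymmetric (u t₀)) (h0S : HasNoSwirl (u t₀)) :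
    ∀ t ∈ Icc t₀ t₁, HasNoSwirl (u t) := by
  intro t ht'
  exact (hu.isAxisymmetric_of_clayForce_Icc hν ht₀ ht hfs hfd h₀ h₁ huE hfA h0A t
    ht').hasNoSwirl_of_conj_reflY_eq
    (hu.conj_eq_of_clayForce_Icc reflY hν ht₀ ht hfs hfd h₀ h₁ huE
      (fun s hs y => (hfA s hs).conj_reflY_eq (hfS s hs) y) (h0A.conj_reflY_eq h0S) t ht')

end Shift

end Literature.Analysis.FluidPDE

end
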